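import Summits.ValiantsHypothesis.ValiantsHypothesis.Theses.SymPencil
import Literature.Computability.AlgebraicComplexity.EquivariantDC

/-!
# Route SymPencil — glued split of the deciding crux `SdcThesis` (item stmt-ValiantsHypothesis-5673)
# along the FINITE-SYMMETRY seam: `SymmetrizePermPairs → EquivariantSdcNotQP → SdcThesis`

`SdcThesis` (the symmetric determinantal complexity of the permanent is not quasi-polynomially
bounded) is the Extended Valiant Hypothesis in the symmetric model, hence at least the summit.  This
file PROVES that it follows from two typed pieces, neither of which is a restatement:

* `EquivariantSdcNotQP` (X₂, the EQUIVARIANT LOWER BOUND, weaker than `SdcThesis`): there is no `c`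
  such that every `per_n` is `det A` for a SYMMETRIC affine pencil `A` of size `≤ 2^{(log₂ n + c)^c}`
  that is EQUIVARIANT — exact lifts `A(γ·x) = g A(x) h⁻¹`, `(g,h) ∈ GL_m × GL_m`, the tree's
  `IsEquivariantDetRepr` (Landsberg–Ressayre 2017 Def. 1.3) — for the finite group `Γ_n ≅ 𝔖_n × 𝔖_n`
  of row and column permutations `x ↦ P x Qᵀ` (NO torus: Landsberg–Ressayre's weight engine, LR17
  Thms 2.1/2.8, PROVED in the tree, needs the diagonal torus; Dawar–Wilsenach's symmetric-circuit
  bound, ToC 2025 Thm 7.1, needs permutation-matrix lifts; linear lifts of a torus-free group sit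
  strictly between and are open).
* `SymmetrizePermPairs` (X₁, SYMMETRISATION AT QUASI-POLYNOMIAL COST, the symmetric-model and
  finite-group form of Landsberg–Ressayre's Question 2.2 / route DetQP's crux `DetqpSymmetrization`):
  every symmetric affine pencil of size `m` for `per_n` can be replaced by a `Γ_n`-equivariant
  symmetric one of size `≤ 2^{(log₂ m + d)^d}`, `d` absolute (naive averaging costs `(n!)²·poly(m)`;
  the det-analogue of cheap symmetrisation is FALSE in the regular model, Ikenmeyer–Landsberg 2017).

Assembly (`sdcThesis_of_subs`): a quasi-polynomial family of symmetric pencils would, by X₁, give a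
quasi-polynomial family of EQUIVARIANT symmetric pencils (qp ∘ qp = qp: `qpExp_comp`,
`((L+c)^c + d)^d ≤ (L + (c+1)(d+1))^{(c+1)(d+1)}`), contradicting X₂.

The group `Γ_n` is written inline (no Literature definition yet) as the subgroup of
`GL (Fin n × Fin n) ℂ` generated by the permutation matrices `Equiv.Perm.permMatrix ℂ (Equiv.prodCongr π ρ)`
(`π, ρ : Equiv.Perm (Fin n)`), a set closed under inverse and transpose, so the generated group of
substitutions does not depend on the left/right convention of `linSubst`.

References: Landsberg–Ressayre 2017 (arXiv:1508.05788) Def. 1.3, Question 2.2, Thms 2.1, 2.8;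
Dawar–Wilsenach, ToC 2025 (arXiv:2002.06451) Thms 4.1, 7.1; Ikenmeyer–Landsberg 2017
(arXiv:1610.00159) §3; Grenet–Kaltofen–Koiran–Portier 2011 (arXiv:1007.3804) Thms 4, 5.
-/

noncomputable section

-- single-conjunct layout: Sub = Summit, duplicated namespace component intended
set_option linter.dupNamespace false

namespace Summit.ValiantsHypothesis.ValiantsHypothesis.Theorems.SymPencilSdcThesisSplit

open Literature.Computability.AlgebraicComplexity MvPolynomial Matrix
open Summit.ValiantsHypothesis.ValiantsHypothesis.Theses

/-- qp ∘ qp = qp, exponent bookkeeping: `((L + c)^c + d)^d ≤ (L + e)^e` with `e = (c+1)(d+1)`.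
[folklore] -/
theorem qpExp_comp (L c d : ℕ) :
    ((L + c) ^ c + d) ^ d ≤ (L + (c + 1) * (d + 1)) ^ ((c + 1) * (d + 1)) := by
  set a := L + c + d + 1 with ha
  have hac : (L + c) ^ c ≤ a ^ c := Nat.pow_le_pow_left (by omega) c
  have ha1 : 1 ≤ a ^ c := Nat.one_le_pow _ _ (by omega)
  have h1 : (L + c) ^ c + d ≤ a ^ (c + 1) := by
    calc (L + c) ^ c + d ≤ a ^ c + d * a ^ c := by nlinarith
      _ = (d + 1) * a ^ c := by ring
      _ ≤ a * a ^ c := Nat.mul_le_mul_right _ (by omega)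
      _ = a ^ (c + 1) := by ring
  have h2 : ((L + c) ^ c + d) ^ d ≤ (a ^ (c + 1)) ^ d := Nat.pow_le_pow_left h1 d
  have hcd : c + d + 1 ≤ (c + 1) * (d + 1) := by nlinarith
  have h4 : a ≤ L + (c + 1) * (d + 1) := by omega
  have h5 : a ^ ((c + 1) * d) ≤ (L + (c + 1) * (d + 1)) ^ ((c + 1) * d) :=
    Nat.pow_le_pow_left h4 _
  have h6 : (L + (c + 1) * (d + 1)) ^ ((c + 1) * d) ≤
      (L + (c + 1) * (d + 1)) ^ ((c + 1) * (d + 1)) :=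
    Nat.pow_le_pow_right (by nlinarith) (by nlinarith)
  calc ((L + c) ^ c + d) ^ d ≤ (a ^ (c + 1)) ^ d := h2
    _ = a ^ ((c + 1) * d) := by rw [← pow_mul]
    _ ≤ (L + (c + 1) * (d + 1)) ^ ((c + 1) * d) := h5
    _ ≤ (L + (c + 1) * (d + 1)) ^ ((c + 1) * (d + 1)) := h6

/-- qp ∘ qp = qp, in the shape of the route's bounds: if `m ≤ 2^{(log₂ n + c)^c}` then
`2^{(log₂ m + d)^d} ≤ 2^{(log₂ n + e)^e}` with `e = (c+1)(d+1)`. [folklore] -/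
theorem qpBound_comp_qpBound {n m c d : ℕ} (hm : m ≤ 2 ^ ((Nat.log 2 n + c) ^ c)) :
    2 ^ ((Nat.log 2 m + d) ^ d) ≤ 2 ^ ((Nat.log 2 n + (c + 1) * (d + 1)) ^ ((c + 1) * (d + 1))) := by
  apply Nat.pow_le_pow_right (by norm_num)
  have hlog : Nat.log 2 m ≤ (Nat.log 2 n + c) ^ c := by
    calc Nat.log 2 m ≤ Nat.log 2 (2 ^ ((Nat.log 2 n + c) ^ c)) := Nat.log_mono_right hm
      _ = (Nat.log 2 n + c) ^ c := Nat.log_pow one_lt_two _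
  calc (Nat.log 2 m + d) ^ d ≤ ((Nat.log 2 n + c) ^ c + d) ^ d := Nat.pow_le_pow_left (by omega) d
    _ ≤ _ := qpExp_comp _ c d

/-- **Glued split of `SdcThesis` (route SymPencil, item stmt-ValiantsHypothesis-5673).**
`SymmetrizePermPairs → EquivariantSdcNotQP → SdcThesis`: the two hypotheses are spelled out verbatim
(they become the route's items `SymPencil.SymmetrizePermPairs` and `SymPencil.EquivariantSdcNotQP`
by `route edit --split SdcThesis`).  Proof: a quasi-polynomial family of symmetric pencils for the
permanents is symmetrised member by member (X₁) into a quasi-polynomial family of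
`Γ_n`-equivariant symmetric pencils (`qpBound_comp_qpBound`), which X₂ forbids. -/
theorem sdcThesis_of_subs
    (h₁ : ∃ d : ℕ, ∀ (n m : ℕ) (A : Matrix (Fin m) (Fin m) (MvPolynomial (Fin n × Fin n) ℂ)),
      A.IsSymm → Literature.Computability.AlgebraicComplexity.IsAffineDetRepr
        (Literature.Computability.AlgebraicComplexity.perPoly (Fin n) ℂ) A →
      ∃ m' ≤ 2 ^ ((Nat.log 2 m + d) ^ d),
        ∃ A' : Matrix (Fin m') (Fin m') (MvPolynomial (Fin n × Fin n) ℂ), A'.IsSymm ∧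
          Literature.Computability.AlgebraicComplexity.IsEquivariantDetRepr
            (Subgroup.closure {γ : GL (Fin n × Fin n) ℂ | ∃ π ρ : Equiv.Perm (Fin n),
              (γ : Matrix (Fin n × Fin n) (Fin n × Fin n) ℂ) = Equiv.Perm.permMatrix ℂ (Equiv.prodCongr π ρ)})
            (Literature.Computability.AlgebraicComplexity.perPoly (Fin n) ℂ) A')
    (h₂ : ¬ ∃ c : ℕ, ∀ n : ℕ, ∃ m ≤ 2 ^ ((Nat.log 2 n + c) ^ c),
      ∃ A : Matrix (Fin m) (Fin m) (MvPolynomial (Fin n × Fin n) ℂ), A.IsSymm ∧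
        Literature.Computability.AlgebraicComplexity.IsEquivariantDetRepr
          (Subgroup.closure {γ : GL (Fin n × Fin n) ℂ | ∃ π ρ : Equiv.Perm (Fin n),
            (γ : Matrix (Fin n × Fin n) (Fin n × Fin n) ℂ) = Equiv.Perm.permMatrix ℂ (Equiv.prodCongr π ρ)})
          (Literature.Computability.AlgebraicComplexity.perPoly (Fin n) ℂ) A) :
    SymPencil.SdcThesis := by
  rintro ⟨c, hc⟩
  obtain ⟨d, hd⟩ := h₁
  apply h₂
  refine ⟨(c + 1) * (d + 1), fun n => ?_⟩
  obtain ⟨m, hm, A, hAs, hA⟩ := hc n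
  obtain ⟨m', hm', A', hA's, hA'⟩ := hd n m A hAs hA
  exact ⟨m', hm'.trans (qpBound_comp_qpBound hm), A', hA's, hA'⟩

/-- **Glue item `SymPencil.SdcThesisOfSubs` (stmt-ValiantsHypothesis-17813), PROVED**: closed by
`sdcThesis_of_subs` by unfolding (route file rev ≥ 2 carries the two children verbatim), i.e. the
deciding crux `SdcThesis` is DERIVED from the two new cruxes `SymmetrizePermPairs` (stmt-17793) and
`EquivariantSdcNotQP` (stmt-17792).  Land with `--workitem stmt-ValiantsHypothesis-17813`. -/
theorem sdcThesisOfSubs_proof : SymPencil.SdcThesisOfSubs := fun h₁ h₂ => sdcThesis_of_subs h₁ h₂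

theorem sdcThesis_derived (h₁ : SymPencil.SymmetrizePermPairs) (h₂ : SymPencil.EquivariantSdcNotQP) :
    SymPencil.SdcThesis := sdcThesis_of_subs h₁ h₂

end Summit.ValiantsHypothesis.ValiantsHypothesis.Theorems.SymPencilSdcThesisSplit
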